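import Mathlib
import Summits.NavierStokesRegularity.NavierStokesRegularity.Theses.DulacContraction
import HarnessLib

/-!
# Route DulacContraction — support item `TargetOfCruxes` PROVED (stmt-NavierStokesRegularity-8564;
  pure-logic glue)

`SynchronizationModSimilarity → SynchronizationForcesSelfSimilarity → RDSSLiouvilleInClass →
RecurrentReduction → SmoothRepresentative → NoTypeIRateProfile`: a singular class profile yields a
recurrent singular one (`RecurrentReduction`), then a smooth recurrent singular one
(`SmoothRepresentative`), which K2 fed with K1 makes rotated-DSS (`SynchronizationForcesSelfSimilarity`
∘ `SynchronizationModSimilarity`) and the self-similar wall (`RDSSLiouvilleInClass`) makes regular —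
contradiction. Exactly the inner steps of the route's deciding theorem `closes`.

HONEST FRAMING: pure logic; all five hypotheses remain OPEN items of the route; nothing here bears on
the regularity question. Lands `--workitem stmt-NavierStokesRegularity-8564` (typer seat g19 of cell
pub-ns-dss, idle-row item).
-/

namespace Summit.NavierStokesRegularity.NavierStokesRegularity.Theorems

set_option linter.dupNamespace false

/-- **`TargetOfCruxes` of route DulacContraction (stmt-NavierStokesRegularity-8564)**, pure logic
over the route's items (template form, by declaration name). [this file] -/
theorem dulacContraction_targetOfCruxes_proof : Theses.DulacContraction.TargetOfCruxes := by
  intro hK1 hK2 hW hRec hRep u p G C hsw hgr hIb hdecay hsing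
  -- a uniformly recurrent singular profile with the same rate constant
  obtain ⟨w₁, q₁, H₁, hsw₁, hgr₁, hIb₁, hdec₁, hsing₁, hrec₁⟩ :=
    hRec u p G C hsw hgr hIb hdecay hsing
  -- its smooth interior representative (still singular, still recurrent)
  obtain ⟨w₂, q₂, H₂, ⟨hsw₂, hgr₂, hIb₂, hdec₂⟩, hcl₂, -, hsingT, hrecT⟩ :=
    hRep w₁ q₁ H₁ C hsw₁ hgr₁ hIb₁ hdec₁
  have hsing₂ := hsingT hsing₁
  have hrec₂ := hrecT hrec₁
  -- K2 fed with K1 at rate C: the profile is invariant under a similarity with factor l > 1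
  have hss := hK2 C (hK1 C) w₂ q₂ H₂ hsw₂ hgr₂ hIb₂ hdec₂ hcl₂ hsing₂ hrec₂
  -- the self-similar wall: such a profile is regular at the origin — contradiction
  exact hW w₂ q₂ H₂ C hsw₂ hgr₂ hIb₂ hdec₂ hcl₂ hss hsing₂

end Summit.NavierStokesRegularity.NavierStokesRegularity.Theorems
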